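import Summits.Ventures.Crystal3D.Theorems.StickyWulffConstantCoaxialWallLawLaminar
import Summits.Ventures.Crystal3D.Theorems.StickyWulffConstantCoaxialWallLawOffPlaneLocal
import Summits.Ventures.Crystal3D.Theorems.StickyWulffConstantCoaxialWallLawOffSite
import HarnessLib

/-!
# The off-plane budget law of `stub_coaxialTwoSlabAdhesion`: arbitrary fillings, charge `√6/3` up to the off-plane contacts of on-plane balls

HONEST FRAMING. Part of the venture `Summits/Ventures/Crystal3D` (cell `crystal3d-full`), helper
`--supports` the crux `CoaxialWallLaw` (stmt-Ventures-19481, `route-Ventures-StickyWulffConstant`),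
REGISTERED line `WallLedgerF` (planner cf-p1 gen 16), open stub `stub_coaxialTwoSlabAdhesion`.
RUNG CREDIT ONLY; F-C1 not moved.  The laminar rung `…CoaxialWallLawLaminar` (every ball on a common basal plane)
made quantitative for ARBITRARY fillings, exactly as `…OffSite` did for the on-site rung — but with the SMALLER
budget: only contacts between an on-plane ball and a ball STRICTLY BETWEEN the basal planes are charged back
(in-plane disorder is free of charge, it is covered by the hexagon rigidity of `…LaminarEnd`).

For height-compatible frame data (`⟪L⁻¹(s₂ − s₁), e₃⟫ ∈ √(2/3)·ℤ`; otherwise every ball of the top grain is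
off-plane and the law is void — the incommensurate case (F-γ) of the planner's ledger), every filling `X` of the
stub's cell satisfies

  `cross(P₁, X∖P₁) + cross(P₂, Y) ≤ D(Y) + (φ₁ + φ₂ − (√6/3)·sin θ) πρ² + C(1+h)ρ + ½·B′`,
  `B′ := Σ_{z ∈ X on-plane, −R₀−2 ≤ z₂ ≤ h+R₀+2} #{q ∈ X : |q − z| = 1, q off the basal planes}`.

Mechanism: both grains' rows along the best signed in-plane class end (with predecessor, `…InPlaneRunEndsPred`) at
disjoint on-plane balls, each of which has `deg ≤ 11 + off(z)` (`…OffPlaneLocal`); the payer assembly with budget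
(`…OffSite.twoSlab_cross_le_of_deficit_budget`).

* `onPlane_of_mem_coaxialGrain` — balls of a grain `⊆ L·B(σ) + s` lie on the basal planes of `(L, s)`; with a
  height-compatible second origin also on those of `(L, s₁)` (`onPlane_of_mem_coaxialGrain_of_compat`).
* `offPlane_payers_ge_class` — per class: `Σ_window (12 − deg) ≥ (4/3)√2|⟪Lv, e₃⟫|πρ² − 2(12√2π + 120R₀)ρ − B′`.
* **`coaxialTwoSlabAdhesion_offPlane`** — the law displayed above (explicit frame, `R₀ = 10`).

WHAT THIS IS NOT: no bound on `B′` (count form and the thin-off-plane corollary: `…CoaxialWallLawOffPlaneCount`);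
nothing for height-incommensurate pairs; F-C1 not moved.
-/

noncomputable section

namespace Summit.Ventures.Crystal3D.Theorems

open Summit.Ventures.Crystal3D Finset
open Literature.MathematicalPhysics.StatisticalMechanics (fccStacking barlowStacking IsHaggSeq
  contactDeficiency triangularVec₁ triangularVec₂ barlowOffset layerNormal)
open scoped InnerProductSpace

/-! ## Grains are on-plane -/

/-- **Balls of a co-axial grain lie on the basal planes of its frame origin.** -/
theorem onPlane_of_mem_coaxialGrain
    (A : EuclideanSpace ℝ (Fin 3) ≃ₗᵢ[ℝ] EuclideanSpace ℝ (Fin 3)) (t : EuclideanSpace ℝ (Fin 3))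
    (L : EuclideanSpace ℝ (Fin 3) ≃ₗᵢ[ℝ] EuclideanSpace ℝ (Fin 3)) (s : EuclideanSpace ℝ (Fin 3))
    {σ : ℤ → ℤ}
    (hsub : (fun p => A p + t) '' fccStacking 1 (Real.sqrt (2 / 3)) ⊆
      (fun p => L p + s) '' barlowStacking 1 (Real.sqrt (2 / 3)) σ)
    {p : EuclideanSpace ℝ (Fin 3)} (hp : p ∈ (fun p => A p + t) '' fccStacking 1 (Real.sqrt (2 / 3))) :
    ∃ k : ℤ, (L.symm (p - s)) 2 = k * Real.sqrt (2 / 3) := by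
  classical
  have h := laminar_of_onSite L s {p} (fun q hq => by
    rw [mem_singleton] at hq; subst hq; exact site_of_mem_coaxialGrain A t L s hsub _ hp) p (mem_singleton_self p)
  exact h

/-- **Balls of the second grain lie on the basal planes of the first origin when the origins are height-compatible.** -/
theorem onPlane_of_mem_coaxialGrain_of_compat
    (A : EuclideanSpace ℝ (Fin 3) ≃ₗᵢ[ℝ] EuclideanSpace ℝ (Fin 3)) (t : EuclideanSpace ℝ (Fin 3))
    (L : EuclideanSpace ℝ (Fin 3) ≃ₗᵢ[ℝ] EuclideanSpace ℝ (Fin 3)) (s₁ s₂ : EuclideanSpace ℝ (Fin 3))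
    {σ : ℤ → ℤ}
    (hsub : (fun p => A p + t) '' fccStacking 1 (Real.sqrt (2 / 3)) ⊆
      (fun p => L p + s₂) '' barlowStacking 1 (Real.sqrt (2 / 3)) σ)
    (hcompat : ∃ k₀ : ℤ, (L.symm (s₂ - s₁)) 2 = k₀ * Real.sqrt (2 / 3))
    {p : EuclideanSpace ℝ (Fin 3)} (hp : p ∈ (fun p => A p + t) '' fccStacking 1 (Real.sqrt (2 / 3))) :
    ∃ k : ℤ, (L.symm (p - s₁)) 2 = k * Real.sqrt (2 / 3) := by
  obtain ⟨k, hk⟩ := onPlane_of_mem_coaxialGrain A t L s₂ hsub hp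
  obtain ⟨k₀, hk₀⟩ := hcompat
  refine ⟨k + k₀, ?_⟩
  have e : L.symm (p - s₁) = L.symm (p - s₂) + L.symm (s₂ - s₁) := by rw [← map_add]; congr 1; abel
  rw [e, PiLp.add_apply, hk, hk₀]; push_cast; ring

/-! ## The per-class payer bound with budget -/

open scoped Classical in
/-- **Per-class payer bound for arbitrary fillings, off-plane budget**: both grains charged along one signed
in-plane class.  See the module docstring. -/
theorem offPlane_payers_ge_class
    (A₁ : EuclideanSpace ℝ (Fin 3) ≃ₗᵢ[ℝ] EuclideanSpace ℝ (Fin 3)) (t₁ : EuclideanSpace ℝ (Fin 3))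
    (A₂ : EuclideanSpace ℝ (Fin 3) ≃ₗᵢ[ℝ] EuclideanSpace ℝ (Fin 3)) (t₂ : EuclideanSpace ℝ (Fin 3))
    (L : EuclideanSpace ℝ (Fin 3) ≃ₗᵢ[ℝ] EuclideanSpace ℝ (Fin 3)) (s₁ s₂ : EuclideanSpace ℝ (Fin 3))
    {σ σ' : ℤ → ℤ} (hσ : IsHaggSeq σ) (hσ' : IsHaggSeq σ')
    (hsub₁ : (fun p => A₁ p + t₁) '' fccStacking 1 (Real.sqrt (2 / 3)) ⊆
      (fun p => L p + s₁) '' barlowStacking 1 (Real.sqrt (2 / 3)) σ)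
    (hsub₂ : (fun p => A₂ p + t₂) '' fccStacking 1 (Real.sqrt (2 / 3)) ⊆
      (fun p => L p + s₂) '' barlowStacking 1 (Real.sqrt (2 / 3)) σ')
    (hne : (fun p => A₁ p + t₁) '' fccStacking 1 (Real.sqrt (2 / 3)) ≠
      (fun p => A₂ p + t₂) '' fccStacking 1 (Real.sqrt (2 / 3)))
    (hcompat : ∃ k₀ : ℤ, (L.symm (s₂ - s₁)) 2 = k₀ * Real.sqrt (2 / 3))
    (X P₁ P₂ : Finset (EuclideanSpace ℝ (Fin 3))) (R₀ h ρ : ℝ) (hR₀ : 10 ≤ R₀) (hρ : R₀ ≤ ρ)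
    (hX : ∀ p ∈ X, ∀ q ∈ X, p ≠ q → 1 ≤ dist p q)
    (hcell : ∀ p ∈ X, -(2 * R₀) ≤ p 2 ∧ p 2 ≤ h + 2 * R₀ ∧ p 0 ^ 2 + p 1 ^ 2 ≤ ρ ^ 2)
    (hP₁X : P₁ ⊆ X) (hP₂X : P₂ ⊆ X)
    (hP₁ : ∀ p, p ∈ P₁ ↔ (p ∈ (fun q => A₁ q + t₁) '' fccStacking 1 (Real.sqrt (2 / 3)) ∧
      -(2 * R₀) ≤ p 2 ∧ p 2 ≤ -R₀ ∧ p 0 ^ 2 + p 1 ^ 2 ≤ ρ ^ 2))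
    (hP₂ : ∀ p, p ∈ P₂ ↔ (p ∈ (fun q => A₂ q + t₂) '' fccStacking 1 (Real.sqrt (2 / 3)) ∧
      h + R₀ ≤ p 2 ∧ p 2 ≤ h + 2 * R₀ ∧ p 0 ^ 2 + p 1 ^ 2 ≤ ρ ^ 2))
    (i j : ℤ) (hv : ‖(i : ℝ) • triangularVec₁ (1 : ℝ) + (j : ℝ) • triangularVec₂ 1‖ = 1) :
    4 / 3 * Real.sqrt 2 * |⟪L ((i : ℝ) • triangularVec₁ (1 : ℝ) + (j : ℝ) • triangularVec₂ 1),
        EuclideanSpace.single (2 : Fin 3) (1 : ℝ)⟫_ℝ| * Real.pi * ρ ^ 2 -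
        2 * ((12 * Real.sqrt 2 * Real.pi + 120 * R₀) * ρ) -
        ∑ z ∈ X.filter (fun z => (-R₀ - 2 ≤ z 2 ∧ z 2 ≤ h + R₀ + 2) ∧
            ∃ k : ℤ, (L.symm (z - s₁)) 2 = k * Real.sqrt (2 / 3)),
          ((X.filter fun q => dist z q = 1 ∧ ¬ ∃ k : ℤ, (L.symm (q - s₁)) 2 = k * Real.sqrt (2 / 3)).card : ℝ) ≤
      ∑ z ∈ X.filter (fun z => -R₀ - 2 ≤ z 2 ∧ z 2 ≤ h + R₀ + 2),
        ((12 : ℝ) - ((X.filter fun q => dist z q = 1).card : ℝ)) := by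
  set e₃ : EuclideanSpace ℝ (Fin 3) := EuclideanSpace.single (2 : Fin 3) (1 : ℝ) with he₃
  set v : EuclideanSpace ℝ (Fin 3) := (i : ℝ) • triangularVec₁ (1 : ℝ) + (j : ℝ) • triangularVec₂ 1 with hvdef
  set Λ₁ := (fun q => A₁ q + t₁) '' fccStacking 1 (Real.sqrt (2 / 3)) with hΛ₁
  set Λ₂ := (fun q => A₂ q + t₂) '' fccStacking 1 (Real.sqrt (2 / 3)) with hΛ₂
  set off : EuclideanSpace ℝ (Fin 3) → ℕ := fun z =>
    (X.filter fun q => dist z q = 1 ∧ ¬ ∃ k : ℤ, (L.symm (q - s₁)) 2 = k * Real.sqrt (2 / 3)).card with hoff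
  -- the class as a non-descending slot of grain 1 and a non-ascending slot of grain 2
  obtain ⟨ε, hε, w, hw, hAw, hup⟩ := exists_up_slot_of_inPlane_class A₁ t₁ L s₁ hσ hsub₁ i j hv
  have hε' : (-ε = 1 ∨ -ε = -1) := by rcases hε with h | h <;> rw [h] <;> norm_num
  obtain ⟨w', hw', hAw'⟩ := exists_slot_top_of_inPlane_class A₂ t₂ L s₂ hσ' hsub₂ i j hv hε'
  have hopp : A₂ w' = -A₁ w := by rw [hAw', hAw, neg_smul, map_neg]
  have hdown : ⟪A₂ w', e₃⟫_ℝ ≤ 0 := by rw [hopp, inner_neg_left]; linarith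
  have hE := card_inPlane_runEndsPred_ge_coaxial A₁ t₁ A₂ t₂ L s₁ s₂ hσ hσ' hsub₁ hsub₂ hne X P₁ P₂ R₀ h ρ hR₀ hρ
    hX hcell hP₁X hP₂X hP₁ hP₂ hw hup hε i j hAw
  have hF := card_inPlane_runEndsPred_top_ge_coaxial A₁ t₁ A₂ t₂ L s₁ s₂ hσ hσ' hsub₁ hsub₂ hne X P₁ P₂ R₀ h ρ
    hR₀ hρ hX hcell hP₁X hP₂X hP₁ hP₂ hw' hdown hε' i j hAw'
  -- both slots carry the class flux
  have habs : |⟪A₁ w, e₃⟫_ℝ| = |⟪L v, e₃⟫_ℝ| := by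
    rw [hAw]
    rcases hε with h | h
    · rw [h, one_smul]
    · rw [h, neg_one_smul, map_neg, inner_neg_left, abs_neg]
  have habs' : |⟪A₂ w', e₃⟫_ℝ| = |⟪L v, e₃⟫_ℝ| := by rw [hopp, inner_neg_left, abs_neg, habs]
  rw [habs] at hE
  rw [habs'] at hF
  -- both slots are unit vectors of the basal plane
  have hvn : ⟪v, e₃⟫_ℝ = 0 := by
    rw [hvdef, inner_add_left, inner_smul_left, inner_smul_left, inner_triangularVec_e₃.1,
      inner_triangularVec_e₃.2]
    simp
  have hdn : ⟪A₁ w, L e₃⟫_ℝ = 0 := by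
    rw [hAw, LinearIsometryEquiv.inner_map_map, inner_smul_left, hvn, mul_zero]
  have hdn' : ⟪A₂ w', L e₃⟫_ℝ = 0 := by rw [hopp, inner_neg_left, hdn, neg_zero]
  have hd1 : ‖A₁ w‖ = 1 := by rw [LinearIsometryEquiv.norm_map, norm_eq_one_of_mem_fccSlots hw]
  have hd1' : ‖A₂ w'‖ = 1 := by rw [LinearIsometryEquiv.norm_map, norm_eq_one_of_mem_fccSlots hw']
  -- the window, its on-plane part, the two end sets
  set Xwin := X.filter fun z => -R₀ - 2 ≤ z 2 ∧ z 2 ≤ h + R₀ + 2 with hXwin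
  set Xon := X.filter (fun z => (-R₀ - 2 ≤ z 2 ∧ z 2 ≤ h + R₀ + 2) ∧
    ∃ k : ℤ, (L.symm (z - s₁)) 2 = k * Real.sqrt (2 / 3)) with hXon
  set E₁ := X.filter fun e => e ∈ Λ₁ ∧ e ∉ Λ₂ ∧ e + A₁ w ∉ X ∧ e - A₁ w ∈ X ∧ -R₀ - 2 ≤ e 2 ∧
    e 2 ≤ h + R₀ + 2 with hE₁
  set E₂ := X.filter fun e => e ∈ Λ₂ ∧ e ∉ Λ₁ ∧ e + A₂ w' ∉ X ∧ e - A₂ w' ∈ X ∧ -R₀ - 2 ≤ e 2 ∧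
    e 2 ≤ h + R₀ + 2 with hE₂
  have hdisj : Disjoint E₁ E₂ := by
    rw [Finset.disjoint_left]
    intro e h1 h2
    exact (mem_filter.1 h1).2.2.1 (mem_filter.1 h2).2.1
  have hon₁ : ∀ e ∈ Λ₁, ∃ k : ℤ, (L.symm (e - s₁)) 2 = k * Real.sqrt (2 / 3) :=
    fun e he => onPlane_of_mem_coaxialGrain A₁ t₁ L s₁ hsub₁ he
  have hon₂ : ∀ e ∈ Λ₂, ∃ k : ℤ, (L.symm (e - s₁)) 2 = k * Real.sqrt (2 / 3) :=
    fun e he => onPlane_of_mem_coaxialGrain_of_compat A₂ t₂ L s₁ s₂ hsub₂ hcompat he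
  have hsubOn : E₁ ∪ E₂ ⊆ Xon := by
    intro e he
    rcases mem_union.1 he with h1 | h2
    · obtain ⟨heX, heΛ, -, -, -, hlo, hhi⟩ := mem_filter.1 h1
      exact mem_filter.2 ⟨heX, ⟨hlo, hhi⟩, hon₁ e heΛ⟩
    · obtain ⟨heX, heΛ, -, -, -, hlo, hhi⟩ := mem_filter.1 h2
      exact mem_filter.2 ⟨heX, ⟨hlo, hhi⟩, hon₂ e heΛ⟩
  have hOnWin : Xon ⊆ Xwin := by
    intro z hz
    obtain ⟨hzX, hw, -⟩ := mem_filter.1 hz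
    exact mem_filter.2 ⟨hzX, hw⟩
  -- every end pays one at itself, up to its off-plane contacts
  have hone : ∀ z ∈ E₁ ∪ E₂,
      (1 : ℝ) - (off z : ℝ) ≤ (12 : ℝ) - ((X.filter fun q => dist z q = 1).card : ℝ) := by
    intro z hz
    rcases mem_union.1 hz with h1 | h2
    · obtain ⟨hzX, hzΛ, -, hsucc, hpred, -, -⟩ := mem_filter.1 h1
      obtain ⟨kz, hkz⟩ := hon₁ z hzΛ
      have h11 := onPlane_card_contacts_le_eleven_add_off_of_end L s₁ X hX hkz hd1 hdn hpred hsucc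
      have h11' : (((X.filter fun q => dist z q = 1).card : ℕ) : ℝ) ≤ 11 + (off z : ℝ) := by
        rw [hoff]; exact_mod_cast h11
      linarith
    · obtain ⟨hzX, hzΛ, -, hsucc, hpred, -, -⟩ := mem_filter.1 h2
      obtain ⟨kz, hkz⟩ := hon₂ z hzΛ
      have h11 := onPlane_card_contacts_le_eleven_add_off_of_end L s₁ X hX hkz hd1' hdn' hpred hsucc
      have h11' : (((X.filter fun q => dist z q = 1).card : ℕ) : ℝ) ≤ 11 + (off z : ℝ) := by
        rw [hoff]; exact_mod_cast h11
      linarith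
  -- window balls pay non-negative amounts; off-plane contact counts are non-negative
  have hnonneg : ∀ z ∈ Xwin, z ∉ Xon → (0 : ℝ) ≤ (12 : ℝ) - ((X.filter fun q => dist z q = 1).card : ℝ) := by
    intro z _ _
    have := card_filter_dist_eq_one_le_twelve X hX z
    have h' : (((X.filter fun q => dist z q = 1).card : ℕ) : ℝ) ≤ 12 := by exact_mod_cast this
    linarith
  have hnonneg' : ∀ z ∈ Xon, z ∉ E₁ ∪ E₂ →
      (0 : ℝ) ≤ (12 : ℝ) - ((X.filter fun q => dist z q = 1).card : ℝ) + (off z : ℝ) := by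
    intro z _ _
    have := card_filter_dist_eq_one_le_twelve X hX z
    have h' : (((X.filter fun q => dist z q = 1).card : ℕ) : ℝ) ≤ 12 := by exact_mod_cast this
    have h0 : (0 : ℝ) ≤ (off z : ℝ) := Nat.cast_nonneg _
    linarith
  have hcard : ((E₁.card : ℕ) : ℝ) + ((E₂.card : ℕ) : ℝ) = ∑ z ∈ E₁ ∪ E₂, (1 : ℝ) := by
    rw [sum_const, nsmul_eq_mul, mul_one, card_union_of_disjoint hdisj]; push_cast; ring
  -- the chain
  have hstep : ∑ z ∈ E₁ ∪ E₂, (1 : ℝ) - ∑ z ∈ Xon, (off z : ℝ) ≤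
      ∑ z ∈ Xon, ((12 : ℝ) - ((X.filter fun q => dist z q = 1).card : ℝ)) := by
    have h1 : ∑ z ∈ E₁ ∪ E₂, ((1 : ℝ) - (off z : ℝ)) ≤
        ∑ z ∈ E₁ ∪ E₂, ((12 : ℝ) - ((X.filter fun q => dist z q = 1).card : ℝ)) := sum_le_sum hone
    have h2 : ∑ z ∈ E₁ ∪ E₂, (((12 : ℝ) - ((X.filter fun q => dist z q = 1).card : ℝ)) + (off z : ℝ)) ≤
        ∑ z ∈ Xon, (((12 : ℝ) - ((X.filter fun q => dist z q = 1).card : ℝ)) + (off z : ℝ)) :=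
      sum_le_sum_of_subset_of_nonneg hsubOn hnonneg'
    have h3 : ∑ z ∈ E₁ ∪ E₂, (off z : ℝ) ≤ ∑ z ∈ Xon, (off z : ℝ) :=
      sum_le_sum_of_subset_of_nonneg hsubOn (fun _ _ _ => Nat.cast_nonneg _)
    rw [sum_sub_distrib] at h1
    rw [sum_add_distrib, sum_add_distrib] at h2
    linarith
  have hlast : ∑ z ∈ Xon, ((12 : ℝ) - ((X.filter fun q => dist z q = 1).card : ℝ)) ≤
      ∑ z ∈ Xwin, ((12 : ℝ) - ((X.filter fun q => dist z q = 1).card : ℝ)) :=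
    sum_le_sum_of_subset_of_nonneg hOnWin hnonneg
  have hsumoff : ∑ z ∈ Xon, (off z : ℝ) = ∑ z ∈ Xon,
      ((X.filter fun q => dist z q = 1 ∧ ¬ ∃ k : ℤ, (L.symm (q - s₁)) 2 = k * Real.sqrt (2 / 3)).card : ℝ) := by
    rw [hoff]
  linarith [hE, hF, hcard, hstep, hlast, hsumoff]

/-! ## The off-plane budget law -/

open scoped Classical in
/-- **The OFF-PLANE budget law of `stub_coaxialTwoSlabAdhesion`** (arbitrary fillings, constant `√6/3`, explicit
height-compatible frame): the stub's inequality up to `½·B′`, `B′` = the off-plane contacts of the on-plane window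
balls.  See the module docstring. -/
theorem coaxialTwoSlabAdhesion_offPlane
    (A₁ : EuclideanSpace ℝ (Fin 3) ≃ₗᵢ[ℝ] EuclideanSpace ℝ (Fin 3)) (t₁ : EuclideanSpace ℝ (Fin 3))
    (A₂ : EuclideanSpace ℝ (Fin 3) ≃ₗᵢ[ℝ] EuclideanSpace ℝ (Fin 3)) (t₂ : EuclideanSpace ℝ (Fin 3))
    (L : EuclideanSpace ℝ (Fin 3) ≃ₗᵢ[ℝ] EuclideanSpace ℝ (Fin 3)) (s₁ s₂ : EuclideanSpace ℝ (Fin 3))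
    {σ σ' : ℤ → ℤ} (hσ : IsHaggSeq σ) (hσ' : IsHaggSeq σ')
    (hsub₁ : (fun p => A₁ p + t₁) '' fccStacking 1 (Real.sqrt (2 / 3)) ⊆
      (fun p => L p + s₁) '' barlowStacking 1 (Real.sqrt (2 / 3)) σ)
    (hsub₂ : (fun p => A₂ p + t₂) '' fccStacking 1 (Real.sqrt (2 / 3)) ⊆
      (fun p => L p + s₂) '' barlowStacking 1 (Real.sqrt (2 / 3)) σ')
    (hne : (fun p => A₁ p + t₁) '' fccStacking 1 (Real.sqrt (2 / 3)) ≠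
      (fun p => A₂ p + t₂) '' fccStacking 1 (Real.sqrt (2 / 3)))
    (hcompat : ∃ k₀ : ℤ, (L.symm (s₂ - s₁)) 2 = k₀ * Real.sqrt (2 / 3)) :
    ∃ C R₀ : ℝ, 1 ≤ R₀ ∧ ∀ h : ℝ, 0 ≤ h → ∀ ρ : ℝ, R₀ ≤ ρ →
      ∀ X P₁ P₂ : Finset (EuclideanSpace ℝ (Fin 3)),
      (∀ p ∈ X, ∀ q ∈ X, p ≠ q → 1 ≤ dist p q) → P₁ ⊆ X → P₂ ⊆ X \ P₁ →
      (∀ p ∈ X, -(2 * R₀) ≤ p 2 ∧ p 2 ≤ h + 2 * R₀ ∧ p 0 ^ 2 + p 1 ^ 2 ≤ ρ ^ 2) →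
      (∀ p, p ∈ P₁ ↔ (p ∈ (fun q => A₁ q + t₁) '' fccStacking 1 (Real.sqrt (2 / 3)) ∧
        -(2 * R₀) ≤ p 2 ∧ p 2 ≤ -R₀ ∧ p 0 ^ 2 + p 1 ^ 2 ≤ ρ ^ 2)) →
      (∀ p, p ∈ P₂ ↔ (p ∈ (fun q => A₂ q + t₂) '' fccStacking 1 (Real.sqrt (2 / 3)) ∧
        h + R₀ ≤ p 2 ∧ p 2 ≤ h + 2 * R₀ ∧ p 0 ^ 2 + p 1 ^ 2 ≤ ρ ^ 2)) →
      ((((P₁ ×ˢ (X \ P₁)).filter fun pq => dist pq.1 pq.2 = 1).card : ℕ) : ℝ) +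
        ((((P₂ ×ˢ ((X \ P₁) \ P₂)).filter fun pq => dist pq.1 pq.2 = 1).card : ℕ) : ℝ) ≤
        contactDeficiency ((X \ P₁) \ P₂) +
          (Real.sqrt 2 / 4 * ∑ᶠ w ∈ {w ∈ fccStacking 1 (Real.sqrt (2 / 3)) | ‖w‖ = 1},
              |⟪w, A₁.symm (EuclideanSpace.single (2 : Fin 3) (1 : ℝ))⟫_ℝ| +
            Real.sqrt 2 / 4 * ∑ᶠ w ∈ {w ∈ fccStacking 1 (Real.sqrt (2 / 3)) | ‖w‖ = 1},
              |⟪w, A₂.symm (EuclideanSpace.single (2 : Fin 3) (1 : ℝ))⟫_ℝ| -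
            (Real.sqrt 6 / 3 : ℝ) * Real.sqrt (1 - ⟪L (EuclideanSpace.single (2 : Fin 3) (1 : ℝ)),
              (EuclideanSpace.single (2 : Fin 3) (1 : ℝ))⟫_ℝ ^ 2)) * Real.pi * ρ ^ 2 +
          C * (1 + h) * ρ +
          1 / 2 * ∑ z ∈ X.filter (fun z => (-R₀ - 2 ≤ z 2 ∧ z 2 ≤ h + R₀ + 2) ∧
              ∃ k : ℤ, (L.symm (z - s₁)) 2 = k * Real.sqrt (2 / 3)),
            ((X.filter fun q => dist z q = 1 ∧ ¬ ∃ k : ℤ, (L.symm (q - s₁)) 2 = k * Real.sqrt (2 / 3)).card : ℝ) := by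
  set e₃ : EuclideanSpace ℝ (Fin 3) := EuclideanSpace.single (2 : Fin 3) (1 : ℝ) with he₃
  set s : ℝ := Real.sqrt (1 - ⟪L e₃, e₃⟫_ℝ ^ 2) with hs
  have hs0 : 0 ≤ s := Real.sqrt_nonneg _
  obtain ⟨Cpa, hCpa⟩ := twoSlab_cross_le_of_deficit_budget A₁ t₁ A₂ t₂ 10 (by norm_num)
  set C₀ : ℝ := 2 * (12 * Real.sqrt 2 * Real.pi + 120 * 10) with hC₀
  have hC₀0 : 0 ≤ C₀ := by positivity
  obtain ⟨hn₁, hn₂, hn₁₂⟩ := norm_triangularVec_one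
  have hv₁ : (((1 : ℤ) : ℝ)) • triangularVec₁ (1 : ℝ) + (((0 : ℤ) : ℝ)) • triangularVec₂ (1 : ℝ) =
      triangularVec₁ 1 := by simp
  have hv₂ : (((0 : ℤ) : ℝ)) • triangularVec₁ (1 : ℝ) + (((1 : ℤ) : ℝ)) • triangularVec₂ (1 : ℝ) =
      triangularVec₂ 1 := by simp
  have hv₃ : (((-1 : ℤ) : ℝ)) • triangularVec₁ (1 : ℝ) + (((1 : ℤ) : ℝ)) • triangularVec₂ (1 : ℝ) =
      triangularVec₂ 1 - triangularVec₁ 1 := by push_cast; module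
  refine ⟨Cpa + C₀ / 2, 10, by norm_num, ?_⟩
  intro h hh ρ hρ X P₁ P₂ hX hP₁X hP₂X₁ hcell hP₁ hP₂
  have hP₂X : P₂ ⊆ X := hP₂X₁.trans sdiff_subset
  have hρ0 : (0 : ℝ) ≤ ρ := by linarith
  set B : ℝ := ∑ z ∈ X.filter (fun z => (-(10 : ℝ) - 2 ≤ z 2 ∧ z 2 ≤ h + 10 + 2) ∧
      ∃ k : ℤ, (L.symm (z - s₁)) 2 = k * Real.sqrt (2 / 3)),
    ((X.filter fun q => dist z q = 1 ∧ ¬ ∃ k : ℤ, (L.symm (q - s₁)) 2 = k * Real.sqrt (2 / 3)).card : ℝ) with hB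
  -- the three per-class payer bounds
  have h₁ := offPlane_payers_ge_class A₁ t₁ A₂ t₂ L s₁ s₂ hσ hσ' hsub₁ hsub₂ hne hcompat X P₁ P₂ 10 h ρ le_rfl hρ hX
    hcell hP₁X hP₂X hP₁ hP₂ 1 0 (by rw [hv₁]; exact hn₁)
  have h₂ := offPlane_payers_ge_class A₁ t₁ A₂ t₂ L s₁ s₂ hσ hσ' hsub₁ hsub₂ hne hcompat X P₁ P₂ 10 h ρ le_rfl hρ hX
    hcell hP₁X hP₂X hP₁ hP₂ 0 1 (by rw [hv₂]; exact hn₂)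
  have h₃ := offPlane_payers_ge_class A₁ t₁ A₂ t₂ L s₁ s₂ hσ hσ' hsub₁ hsub₂ hne hcompat X P₁ P₂ 10 h ρ le_rfl hρ hX
    hcell hP₁X hP₂X hP₁ hP₂ (-1) 1 (by rw [hv₃]; exact hn₁₂)
  rw [hv₁] at h₁
  rw [hv₂] at h₂
  rw [hv₃] at h₃
  -- the best class carries half of the total flux, which carries the sine
  set x₁ : ℝ := ⟪L (triangularVec₁ 1), e₃⟫_ℝ with hx₁
  set x₂ : ℝ := ⟪L (triangularVec₂ 1), e₃⟫_ℝ with hx₂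
  have hx₃ : ⟪L (triangularVec₂ 1 - triangularVec₁ 1), e₃⟫_ℝ = x₂ - x₁ := by
    rw [map_sub, inner_sub_left]
  rw [hx₃] at h₃
  have hflux : Real.sqrt 6 * s ≤ Real.sqrt 2 * (|x₁| + |x₂| + |x₂ - x₁|) := by
    have := coaxial_sine_le_inPlaneClasses L
    rw [hx₃] at this
    exact this
  set S : ℝ := ∑ z ∈ X.filter (fun z => -(10 : ℝ) - 2 ≤ z 2 ∧ z 2 ≤ h + 10 + 2),
    ((12 : ℝ) - ((X.filter fun q => dist z q = 1).card : ℝ)) with hS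
  have hpay : (2 / 3 * Real.sqrt 6 * s) * Real.pi * ρ ^ 2 - C₀ * (1 + h) * ρ - B ≤ S := by
    set Q : ℝ := Real.sqrt 2 * Real.pi * ρ ^ 2 with hQ
    have hQ0 : 0 ≤ Q := by positivity
    have e₁ : 4 / 3 * Real.sqrt 2 * |x₁| * Real.pi * ρ ^ 2 = 4 / 3 * |x₁| * Q := by rw [hQ]; ring
    have e₂ : 4 / 3 * Real.sqrt 2 * |x₂| * Real.pi * ρ ^ 2 = 4 / 3 * |x₂| * Q := by rw [hQ]; ring
    have e₃' : 4 / 3 * Real.sqrt 2 * |x₂ - x₁| * Real.pi * ρ ^ 2 = 4 / 3 * |x₂ - x₁| * Q := by rw [hQ]; ring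
    rw [e₁] at h₁
    rw [e₂] at h₂
    rw [e₃'] at h₃
    have eC : C₀ * ρ = 2 * ((12 * Real.sqrt 2 * Real.pi + 120 * 10) * ρ) := by rw [hC₀]; ring
    have hbest : 2 / 3 * (|x₁| + |x₂| + |x₂ - x₁|) * Q - C₀ * ρ - B ≤ S := by
      rw [eC]
      rcases two_mul_abs_ge_sum_three x₁ x₂ with hm | hm | hm
      · have := mul_le_mul_of_nonneg_right hm hQ0
        linarith
      · have := mul_le_mul_of_nonneg_right hm hQ0
        linarith
      · have := mul_le_mul_of_nonneg_right hm hQ0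
        linarith
    have h1 : Real.sqrt 6 * s * (Real.pi * ρ ^ 2) ≤ (|x₁| + |x₂| + |x₂ - x₁|) * Q := by
      have := mul_le_mul_of_nonneg_right hflux (show (0 : ℝ) ≤ Real.pi * ρ ^ 2 by positivity)
      have eQ : Real.sqrt 2 * (|x₁| + |x₂| + |x₂ - x₁|) * (Real.pi * ρ ^ 2) = (|x₁| + |x₂| + |x₂ - x₁|) * Q := by
        rw [hQ]; ring
      linarith [eQ]
    have h2 : C₀ * ρ ≤ C₀ * (1 + h) * ρ := by
      have : 0 ≤ C₀ * h * ρ := by positivity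
      linarith [show C₀ * (1 + h) * ρ = C₀ * ρ + C₀ * h * ρ by ring]
    have e4 : (2 / 3 * Real.sqrt 6 * s) * Real.pi * ρ ^ 2 = 2 / 3 * (Real.sqrt 6 * s * (Real.pi * ρ ^ 2)) := by ring
    rw [e4]
    linarith [h1, h2, hbest]
  -- the payer assembly with budget `B`
  have hfin := hCpa h hh ρ hρ X P₁ P₂ hX hP₁X hP₂X₁ hcell hP₁ hP₂ (2 / 3 * Real.sqrt 6 * s) C₀ B hC₀0 hpay
  have e63 : 2 / 3 * Real.sqrt 6 * s / 2 = Real.sqrt 6 / 3 * s := by ring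
  rw [e63] at hfin
  have eB : B / 2 = 1 / 2 * B := by ring
  linarith [hfin, eB]

end Summit.Ventures.Crystal3D.Theorems

end
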